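import Mathlib
import Summits.Ventures.LatticeQCDFlow.TrivializingMaps.HaarIntegrationByParts
import Summits.Ventures.LatticeQCDFlow.TrivializingMaps.JacobianTransport
import Summits.Ventures.LatticeQCDFlow.TrivializingMaps.JacobianTransportWeight
import Summits.Ventures.LatticeQCDFlow.TrivializingMaps.JacobianDensity
import Summits.Ventures.LatticeQCDFlow.TrivializingMaps.JacobianEstimate

/-!
# LatticeQCDFlow / TrivializingMaps — Lüscher's Jacobian formula (3.9): `JacobianFormula d L n` PROVED

HONEST FRAMING: exact (Metropolis-corrected) sampling algorithms for lattice gauge theory; figures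
of merit are autocorrelation/cost numbers at stated couplings and volumes; no continuum-physics claim.

Venture `LatticeQCDFlow` (cell pub-lqcd), topic `TrivializingMaps`, row 31 (lean-2).  File A of the
Lüscher 2010 typing (`Literature/…/Luscher2010/TrivializingMaps.lean`) records eq. (3.9),

  `∫ D[U] 𝒪(U) = ∫ D[V] 𝒪(𝓕_t V) · exp(∫₀ᵗ ds ∑_{x,μ} ∂ᵃ_{x,μ} Zᵃ_s(𝓕_s V))`,

for every `C¹` tangent generator `Z`, every flow map `𝓕 = Φ` of `Z`, every real `t` and every continuous
observable, as the cited `Prop` `JacobianFormula d L n`.  This file proves it: `jacobianFormula_holds`.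

Proof (duality / transport, no Jacobian determinants).  For an ambient `C¹` observable `Õ`, a `C¹` RATE
`c : ℝ × M_n(ℂ)^E → ℝ` and the cut-off ambient flow `Ψ` of `Z` (`JacobianTransport`), the transported
observable `U(s, W) = Õ(Ψ_{s→t} W) exp ∫_s^t c(r, Ψ_{s→r} W) dr` is jointly `C¹` and satisfies
`DU[(1, X)] = -c U` (`JacobianTransportWeight`).  On `SU(n)^E` and for `|s| ≤ T` this reads
`∂_s U = -(Z_s·∇U + (div Z_s) U) + (div Z_s - c) U`, and the first bracket integrates to zero against the
product Haar measure (`HaarIntegrationByParts`).  Hence `|d/ds ∫ D[U] U(s, U)| ≤ δ · sup |U|` where `δ`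
bounds `|div Z - c|` on `[-T, T] × SU(n)^E` (`jacobian_estimate`): the formula with the rate `c` holds
up to `|t| δ sup|U|`.  Choosing `c` a uniform `C¹` approximation of the (cut-off) divergence on a compact
set containing all relevant trajectories (Stone–Weierstrass with the separating dual,
`exists_contDiff_one_approx_on`) and letting `δ → 0` gives (3.9) for `Õ ∘ coe`; density of such
observables (`JacobianDensity`) gives it for every continuous observable.

Only `C¹` regularity of `Z` is used (the divergence is never differentiated), so the cited statement is
discharged verbatim.  With `Luscher2010.flowGlobalExistence_holds` this makes the theory-1 results
`defectControlsLogWeight_of`, `truncatedMapLogWeightBound_of`, `isTrivializingMap_of_flowEquation`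
unconditional.
-/

noncomputable section

open MeasureTheory Matrix Set Filter Function Metric intervalIntegral
open scoped Matrix Topology NNReal

namespace Summit.Ventures.LatticeQCDFlow.TrivializingMaps

open Literature.MathematicalPhysics.QuantumFieldTheory
open Literature.MathematicalPhysics.QuantumFieldTheory.Luscher2010
open Literature.MathematicalPhysics.QuantumFieldTheory.WilsonFlow
open Literature.Analysis.ODE
open scoped Matrix.Norms.Frobenius ContDiff

variable {d L n : ℕ}

/-! ## §4. The Jacobian formula -/

section Main

variable [NeZero L]

/-- **Lüscher's Jacobian formula for ambient `C¹` observables**, `C¹` generators, all real `t`: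
`∫ D[U] Õ(U) = ∫ D[V] Õ(Φ_t V) exp(∫₀ᵗ div Z_s(Φ_s V) ds)` (let the `C¹` rate tend to the divergence).
[cite: Luscher2010Trivializing, §3.2 eq. (3.9)] -/
theorem jacobian_formula_contDiff_one_observable (B : SuBasis n) {Z : Generator d L n}
    (hZ1 : ContDiff ℝ 1 fun p : ℝ × AmbConfig d L n => Z p.1 p.2) (hZt : Z.IsTangent)
    {Φ : ℝ → GaugeConfig d L (Matrix.specialUnitaryGroup (Fin n) ℂ) →
      GaugeConfig d L (Matrix.specialUnitaryGroup (Fin n) ℂ)} (hΦ : IsFlowMap Z Φ) (t : ℝ)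
    {O : AmbConfig d L n → ℝ} (hO : ContDiff ℝ 1 O) :
    ∫ U, O (coeConfig U) ∂(trivialMeasure (Matrix.specialUnitaryGroup (Fin n) ℂ) d L) =
      ∫ V, O (coeConfig (Φ t V)) *
          Real.exp (∫ s in (0 : ℝ)..t, linkDiv B (Z s) (coeConfig (Φ s V)))
        ∂(trivialMeasure (Matrix.specialUnitaryGroup (Fin n) ℂ) d L) := by
  haveI : SecondCountableTopology (Matrix (Fin n) (Fin n) ℂ) :=
    inferInstanceAs (SecondCountableTopology (Fin n → Fin n → ℂ))
  haveI : SecondCountableTopology (Matrix.specialUnitaryGroup (Fin n) ℂ) :=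
    Topology.IsEmbedding.subtypeVal.secondCountableTopology
  haveI : IsProbabilityMeasure (trivialMeasure (Matrix.specialUnitaryGroup (Fin n) ℂ) d L) := by
    unfold trivialMeasure; infer_instance
  set μ := trivialMeasure (Matrix.specialUnitaryGroup (Fin n) ℂ) d L with hμ
  set T : ℝ := |t| + 1 with hT
  have hT0 : 0 < T := by positivity
  have htT : |t| ≤ T := by linarith
  have ht : t ∈ Ioo (-T) T := by constructor <;> cases abs_cases t <;> linarith
  have h0 : (0 : ℝ) ∈ Ioo (-T) T := ⟨by linarith, hT0⟩
  -- trajectory bounds: all `(r, Ψ_{s→r} U)` with `|s|, |r| ≤ T` lie in a fixed compact ball `K`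
  obtain ⟨S, hS0, hS⟩ := exists_speed_bound hZ1 T
  set R : ℝ := (ρ₀ d L n : ℝ) + S * (2 * T) with hR
  have hρR : (ρ₀ d L n : ℝ) ≤ R := by rw [hR]; nlinarith [hS0, hT0]
  have htraj : ∀ (s r : ℝ) (V : GaugeConfig d L (Matrix.specialUnitaryGroup (Fin n) ℂ)), |s| ≤ T → |r| ≤ T →
      ‖cutFlow hZ1 T s r (coeConfig V)‖ ≤ R := by
    intro s r V hs hr
    have h1 := hS s r (coeConfig V)
    have h2 : |r - s| ≤ 2 * T := by
      rw [abs_le] at hs hr ⊢; constructor <;> linarith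
    calc ‖cutFlow hZ1 T s r (coeConfig V)‖
        ≤ ‖cutFlow hZ1 T s r (coeConfig V) - coeConfig V‖ + ‖coeConfig V‖ := norm_le_norm_sub_add _ _
      _ ≤ S * |r - s| + ρ₀ d L n := add_le_add h1 (norm_coeConfig_le V)
      _ ≤ S * (2 * T) + ρ₀ d L n := by gcongr
      _ = R := by rw [hR]; ring
  haveI : ProperSpace (ℝ × AmbConfig d L n) := FiniteDimensional.proper ℝ _
  set K : Set (ℝ × AmbConfig d L n) := closedBall 0 (max T R) with hK
  have hKc : IsCompact K := isCompact_closedBall _ _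
  have hmemK : ∀ (r : ℝ) (W : AmbConfig d L n), |r| ≤ T → ‖W‖ ≤ R → ((r, W) : ℝ × AmbConfig d L n) ∈ K := by
    intro r W hr hW
    rw [hK, mem_closedBall, dist_zero_right, Prod.norm_def, Real.norm_eq_abs]
    exact max_le_max hr hW
  have habs_uIcc : ∀ r ∈ uIcc (0 : ℝ) t, |r| ≤ T := fun r hr => by
    rcases mem_uIcc.1 hr with h | h
    · rw [abs_le]; constructor <;> linarith [le_abs_self t, neg_abs_le t]
    · rw [abs_le]; constructor <;> linarith [le_abs_self t, neg_abs_le t]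
  -- uniform bounds: the cut-off divergence on `K`, the observable on the ball of radius `R`
  have hdivc : Continuous (cutDiv B Z T) :=
    (contDiff_pcut T (m := 0)).continuous.mul (continuous_linkDiv_param B hZ1)
  obtain ⟨D₀, hD₀⟩ := hKc.exists_bound_of_continuousOn hdivc.continuousOn
  set D : ℝ := max D₀ 0 + 1 with hD
  have hD0 : 0 ≤ D := by rw [hD]; positivity
  have hdivD : ∀ (r : ℝ) (V : GaugeConfig d L (Matrix.specialUnitaryGroup (Fin n) ℂ)), |r| ≤ T →
      |linkDiv B (Z r) (coeConfig V)| ≤ D := by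
    intro r V hr
    have := hD₀ _ (hmemK r (coeConfig V) hr ((norm_coeConfig_le V).trans hρR))
    rw [Real.norm_eq_abs, cutDiv_eq_of_abs_le B Z hr] at this
    rw [hD]; linarith [le_max_left D₀ 0]
  obtain ⟨MO₀, hMO₀⟩ := (isCompact_closedBall (0 : AmbConfig d L n) R).exists_bound_of_continuousOn
    hO.continuous.continuousOn
  set MO : ℝ := max MO₀ 0 with hMO
  have hMO' : ∀ W : AmbConfig d L n, ‖W‖ ≤ R → |O W| ≤ MO := fun W hW =>
    ((Real.norm_eq_abs _).symm.le.trans (hMO₀ W (mem_closedBall_zero_iff.2 hW))).trans (le_max_left _ _)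
  set M : ℝ := MO * Real.exp (2 * T * D) with hM
  -- the right-hand side with the true divergence
  set a : GaugeConfig d L (Matrix.specialUnitaryGroup (Fin n) ℂ) → ℝ :=
    fun V => ∫ s in (0 : ℝ)..t, linkDiv B (Z s) (coeConfig (Φ s V)) with ha
  have hflow : ∀ V (r : ℝ), r ∈ Ioo (-T) T → cutFlow hZ1 T 0 r (coeConfig V) = coeConfig (Φ r V) :=
    fun V r hr => cutFlow_eq_coeConfig hZ1 T hΦ hT0 V hr
  have hIoo_of_uIcc : ∀ r ∈ uIcc (0 : ℝ) t, r ∈ Ioo (-T) T := fun r hr => by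
    rcases mem_uIcc.1 hr with h | h
    · exact ⟨lt_of_lt_of_le h0.1 h.1, lt_of_le_of_lt h.2 ht.2⟩
    · exact ⟨lt_of_lt_of_le ht.1 h.1, lt_of_le_of_lt h.2 h0.2⟩
  have hΦc : Continuous (Φ t) := continuous_of_isFlowMap hZ1 hΦ t
  have hOc : Continuous fun V : GaugeConfig d L (Matrix.specialUnitaryGroup (Fin n) ℂ) =>
      O (coeConfig (Φ t V)) := hO.continuous.comp (continuous_coeConfig.comp hΦc)
  have hw2 : Continuous fun V => Real.exp (a V) := continuous_jacobianWeight B hZ1 hΦ t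
  -- for every `δ ∈ (0, 1]` the two sides are `δ · C`-close
  have hclose : ∀ δ : ℝ, 0 < δ → δ ≤ 1 →
      |(∫ U, O (coeConfig U) ∂μ) - ∫ V, O (coeConfig (Φ t V)) * Real.exp (a V) ∂μ| ≤
        δ * (M * |t| + MO * Real.exp (|t| * D) * |t|) := by
    intro δ hδ hδ1
    obtain ⟨c, hc, hcK⟩ := exists_contDiff_one_approx_on hKc hdivc hδ
    -- `|div Z - c| ≤ δ` on `[-T, T] × SU(n)^E`, `|c| ≤ D` on `K`
    have hcδ : ∀ (s : ℝ) (V : GaugeConfig d L (Matrix.specialUnitaryGroup (Fin n) ℂ)), |s| ≤ T →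
        |linkDiv B (Z s) (coeConfig V) - c (s, coeConfig V)| ≤ δ := by
      intro s V hs
      have := hcK _ (hmemK s (coeConfig V) hs ((norm_coeConfig_le V).trans hρR))
      rw [cutDiv_eq_of_abs_le B Z hs V] at this
      exact this.le
    have hcD : ∀ p ∈ K, |c p| ≤ D := by
      intro p hp
      have h1 := hcK p hp
      have h2 : |cutDiv B Z T p| ≤ max D₀ 0 :=
        ((Real.norm_eq_abs _).symm.le.trans (hD₀ p hp)).trans (le_max_left _ _)
      have h3 := abs_sub_abs_le_abs_sub (c p) (cutDiv B Z T p)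
      rw [abs_sub_comm] at h3
      rw [hD]; linarith
    -- the bound `M` on the weighted transported observable
    have hMb : ∀ (s : ℝ) (V : GaugeConfig d L (Matrix.specialUnitaryGroup (Fin n) ℂ)), |s| ≤ T →
        |transportFnW hZ1 T c t O (s, coeConfig V)| ≤ M := by
      intro s V hs
      simp only [transportFnW, logJacW, abs_mul, Real.abs_exp]
      refine mul_le_mul (hMO' _ (htraj s t V hs htT)) ?_ (Real.exp_pos _).le (le_max_right _ _)
      refine Real.exp_le_exp.2 ?_
      have hint : ‖∫ r in s..t, c (r, cutFlow hZ1 T s r (coeConfig V))‖ ≤ D * |t - s| := by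
        refine intervalIntegral.norm_integral_le_of_norm_le_const fun r hr => ?_
        rw [Real.norm_eq_abs]
        have hr : |r| ≤ T := by
          rcases mem_uIcc.1 (uIoc_subset_uIcc hr) with h | h
          · rw [abs_le] at hs ⊢; constructor <;> linarith [le_abs_self t, neg_abs_le t]
          · rw [abs_le] at hs ⊢; constructor <;> linarith [le_abs_self t, neg_abs_le t]
        exact hcD _ (hmemK r _ hr (htraj s r V hs hr))
      have h2 : |t - s| ≤ 2 * T := by
        rw [abs_le] at hs ⊢; constructor <;> linarith [le_abs_self t, neg_abs_le t]
      calc ∫ r in s..t, c (r, cutFlow hZ1 T s r (coeConfig V))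
          ≤ |∫ r in s..t, c (r, cutFlow hZ1 T s r (coeConfig V))| := le_abs_self _
        _ ≤ D * |t - s| := by rwa [Real.norm_eq_abs] at hint
        _ ≤ D * (2 * T) := by gcongr
        _ = 2 * T * D := by ring
    have hest := jacobian_estimate B hZ1 T t hZt hΦ hT hc hO hcδ hMb
    -- compare the two exponents pointwise
    have hexp : ∀ V : GaugeConfig d L (Matrix.specialUnitaryGroup (Fin n) ℂ),
        |Real.exp (∫ r in (0 : ℝ)..t, c (r, coeConfig (Φ r V))) - Real.exp (a V)| ≤
          Real.exp (|t| * D) * (δ * |t|) := by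
      intro V
      have hmem_r : ∀ r ∈ uIcc (0 : ℝ) t, ((r, coeConfig (Φ r V)) : ℝ × AmbConfig d L n) ∈ K :=
        fun r hr => hmemK r _ (habs_uIcc r hr) ((norm_coeConfig_le _).trans hρR)
      have hcurve : Continuous fun r : ℝ => coeConfig (Φ r V) :=
        continuous_iff_continuousAt.2 fun r => (isFlowLine_hasDerivAt_amb (hΦ.2 V) r).continuousAt
      have hi1 : IntervalIntegrable (fun r => c (r, coeConfig (Φ r V))) volume 0 t :=
        (hc.continuous.comp (continuous_id.prodMk hcurve)).intervalIntegrable _ _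
      have hi2 : IntervalIntegrable (fun r => linkDiv B (Z r) (coeConfig (Φ r V))) volume 0 t :=
        ((continuous_linkDiv_param B hZ1).comp₂ continuous_id hcurve).intervalIntegrable _ _
      have hdiff : |(∫ r in (0 : ℝ)..t, c (r, coeConfig (Φ r V))) - a V| ≤ δ * |t| := by
        rw [ha, ← intervalIntegral.integral_sub hi1 hi2]
        have := intervalIntegral.norm_integral_le_of_norm_le_const (a := 0) (b := t) (C := δ)
          (f := fun r => c (r, coeConfig (Φ r V)) - linkDiv B (Z r) (coeConfig (Φ r V))) fun r hr => by
            rw [Real.norm_eq_abs, abs_sub_comm]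
            exact hcδ r (Φ r V) (habs_uIcc r (uIoc_subset_uIcc hr))
        rwa [Real.norm_eq_abs, sub_zero] at this
      have hb1 : (∫ r in (0 : ℝ)..t, c (r, coeConfig (Φ r V))) ≤ |t| * D := by
        have := intervalIntegral.norm_integral_le_of_norm_le_const (a := 0) (b := t) (C := D)
          (f := fun r => c (r, coeConfig (Φ r V))) fun r hr => by
            rw [Real.norm_eq_abs]; exact hcD _ (hmem_r r (uIoc_subset_uIcc hr))
        rw [Real.norm_eq_abs, sub_zero] at this
        exact (le_abs_self _).trans (by linarith [this])
      have hb2 : a V ≤ |t| * D := by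
        have := intervalIntegral.norm_integral_le_of_norm_le_const (a := 0) (b := t) (C := D)
          (f := fun r => linkDiv B (Z r) (coeConfig (Φ r V))) fun r hr => by
            rw [Real.norm_eq_abs]; exact hdivD r (Φ r V) (habs_uIcc r (uIoc_subset_uIcc hr))
        rw [Real.norm_eq_abs, sub_zero] at this
        exact (le_abs_self _).trans (by linarith [this])
      exact (abs_exp_sub_exp_le hb1 hb2).trans (by gcongr)
    have h2 : |(∫ V, O (coeConfig (Φ t V)) * Real.exp (∫ r in (0 : ℝ)..t, c (r, coeConfig (Φ r V))) ∂μ) -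
        ∫ V, O (coeConfig (Φ t V)) * Real.exp (a V) ∂μ| ≤ MO * Real.exp (|t| * D) * (δ * |t|) := by
      have hw1 : Continuous fun V : GaugeConfig d L (Matrix.specialUnitaryGroup (Fin n) ℂ) =>
          Real.exp (∫ r in (0 : ℝ)..t, c (r, coeConfig (Φ r V))) := by
        have hl : Continuous fun V : GaugeConfig d L (Matrix.specialUnitaryGroup (Fin n) ℂ) =>
            logJacW hZ1 T c t 0 (coeConfig V) :=
          (contDiff_logJacW hZ1 T c t hc).continuous.comp₂ continuous_const continuous_coeConfig
        refine (Real.continuous_exp.comp hl).congr fun V => ?_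
        show Real.exp (logJacW hZ1 T c t 0 (coeConfig V)) = _
        simp only [logJacW]
        congr 1
        refine intervalIntegral.integral_congr fun r hr => ?_
        show c (r, cutFlow hZ1 T 0 r (coeConfig V)) = c (r, coeConfig (Φ r V))
        rw [hflow V r (hIoo_of_uIcc r hr)]
      have i1 : Integrable (fun V => O (coeConfig (Φ t V)) *
          Real.exp (∫ r in (0 : ℝ)..t, c (r, coeConfig (Φ r V)))) μ :=
        (BoundedContinuousFunction.mkOfCompact ⟨_, hOc.mul hw1⟩).integrable _
      have i2 : Integrable (fun V => O (coeConfig (Φ t V)) * Real.exp (a V)) μ :=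
        (BoundedContinuousFunction.mkOfCompact ⟨_, hOc.mul hw2⟩).integrable _
      rw [← integral_sub i1 i2]
      have := norm_integral_le_of_norm_le_const (μ := μ) (C := MO * Real.exp (|t| * D) * (δ * |t|))
        (f := fun V => O (coeConfig (Φ t V)) * Real.exp (∫ r in (0 : ℝ)..t, c (r, coeConfig (Φ r V))) -
          O (coeConfig (Φ t V)) * Real.exp (a V)) (ae_of_all _ fun V => ?_)
      · rwa [Real.norm_eq_abs, probReal_univ, mul_one] at this
      · rw [← mul_sub, norm_mul, Real.norm_eq_abs, Real.norm_eq_abs, mul_assoc]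
        refine mul_le_mul (hMO' _ ?_) (hexp V) (abs_nonneg _) (le_max_right _ _)
        rw [← hflow V t ht]; exact htraj 0 t V (by rw [abs_zero]; exact hT0.le) htT
    calc |(∫ U, O (coeConfig U) ∂μ) - ∫ V, O (coeConfig (Φ t V)) * Real.exp (a V) ∂μ|
        ≤ |(∫ U, O (coeConfig U) ∂μ) -
            ∫ V, O (coeConfig (Φ t V)) * Real.exp (∫ r in (0 : ℝ)..t, c (r, coeConfig (Φ r V))) ∂μ| +
          |(∫ V, O (coeConfig (Φ t V)) * Real.exp (∫ r in (0 : ℝ)..t, c (r, coeConfig (Φ r V))) ∂μ) -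
            ∫ V, O (coeConfig (Φ t V)) * Real.exp (a V) ∂μ| := abs_sub_le _ _ _
      _ ≤ δ * M * |t| + MO * Real.exp (|t| * D) * (δ * |t|) := by
          refine add_le_add ?_ h2
          rw [abs_sub_comm]; exact hest
      _ = δ * (M * |t| + MO * Real.exp (|t| * D) * |t|) := by ring
  -- let `δ → 0`
  have habs : |(∫ U, O (coeConfig U) ∂μ) - ∫ V, O (coeConfig (Φ t V)) * Real.exp (a V) ∂μ| ≤ 0 := by
    refine le_of_forall_pos_le_add fun ε hε => ?_
    set C : ℝ := M * |t| + MO * Real.exp (|t| * D) * |t| with hC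
    have hCnn : 0 ≤ C := by positivity
    set δ : ℝ := min 1 (ε / (C + 1)) with hδ
    have hδpos : 0 < δ := lt_min one_pos (div_pos hε (by positivity))
    have h := hclose δ hδpos (min_le_left _ _)
    have hδε : δ * C ≤ ε := by
      have h1 : δ ≤ ε / (C + 1) := min_le_right _ _
      have h2 : δ * (C + 1) ≤ ε := by rwa [le_div_iff₀ (by positivity)] at h1
      nlinarith
    linarith
  exact sub_eq_zero.1 (abs_nonpos_iff.1 habs)

omit [NeZero L] in
/-- **Lüscher 2010 eq. (3.9), PROVED** — discharges the cited `Prop` `JacobianFormula` of file A: for every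
`C¹` tangent generator `Z` on `SU(n)^E`, every flow map `Φ` of `Z` (`IsFlowMap`), every real `t` and every
continuous observable `𝒪`,
`∫ D[U] 𝒪(U) = ∫ D[V] 𝒪(Φ_t V) · exp(∫₀ᵗ ∑_{x,μ,a} ∂ᵃ_{x,μ} Zᵃ_s (Φ_s V) ds)`.
[cite: Luscher2010Trivializing, §3.2 eqs. (3.4)–(3.9)] -/
theorem jacobianFormula_holds : JacobianFormula d L n := by
  intro _ B Z Φ hZ hZt hΦ t O hO
  exact jacobian_formula_of_forall_contDiff B hZ hΦ t
    (fun Õ hÕ => jacobian_formula_contDiff_one_observable B hZ hZt hΦ t hÕ) O hO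

end Main

end Summit.Ventures.LatticeQCDFlow.TrivializingMaps

end
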